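import Summits.BirchSwinnertonDyer.BirchSwinnertonDyer.Theorems.ErratumRoadFiveKolyvaginRestTam
import HarnessLib

/-!
# Route `ErratumRoadFive` (rung K2), crux `Rest3NoWitnessBranchAtFive` (item stmt-BirchSwinnertonDyer-19703, (NW)
# child of REST‴ 19624), registered stub `stub_nw_offLocus` (cw 18 793: (ram), `E(ℚ_p)[p] = 0`, no odd non-split
# `E[p]`-ramified witness, `p ∣ ∏_ℓ c_ℓ(E)`): THE TAMAGAWA-REFINED KOLYVAGIN ROAD — the registered signature VERBATIM
# from the published named facts, McCallum's structure theorem, the JSW17 Thm. 3.3.1-mult control fact and ONE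
# hypothesis-shaped input: a Kolyvagin certificate of level `M + 1`, `M ≤ t := ord_p ∏_ℓ c_ℓ(E)`, at the
# Hoffstein–Luo frames of the pair (W. Zhang's REFINED non-vanishing `M_∞ ≤ t`, ♯-typing) — cell `bsd-stepL`,
# ACCEL seat `bsd-stepL-nw1` g0; `--supports stmt-BirchSwinnertonDyer-19703 --as helper`; Theses-FREE imports

HONEST FRAMING. THEOREMS ONLY (no definition, no named fact, no `sorry`); nothing about Kolyvagin's conjecture, its
refinement, or BSD is asserted; every published ∕ cited named fact is a HYPOTHESIS (`hGZ hKo hSk hGZK hmod hnf hHL hMaz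
hrec hMc h36 h331`: the binders of imc-p1's `Koly.openInputOnTree_onLocus_of_kolyvaginFramesHL_of_thm331Mult` minus
Kolyvagin's index bound `hB`, unused here); the refined non-vanishing statement `hZt` is a HYPOTHESIS, stated inline in
the ∀-frame ♯ shape of the Locus road's `hZ₅` with the mod-`p` class replaced by a level-`(M+1)` certificate,
`M ≤ ord_p ∏ c_ℓ` (koly's `Koly.CertificateAt`, the K0⋆ currency of `X11b/Three/KolyvaginNonvanishing.lean`; at `p = 3`
the typed object `Koly.ZhangAtThreeTamagawa`). BSD is proved for no pair; no census number moves; the OWNER assembles.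

## Why this road, and what the literature does NOT supply (seat nw1's reading, 2026-08-26)

The stub is route p2's open input `P2OpenInputOnTreeAt W p` = the LOWER bound on `Ш(E/K)·Tam` at every odd-`d_K`
classical Heegner datum («`Ch_Λ(X_ac) ⊆ (L_p^BDP)`» at `𝟙` ∘ Cas18 Thm. 3.2), which by the tree's tightness ∕ rigidity
theorems is EXACTLY the main-conjecture half `Typed.MissingLowerBoundAt W p` of `BSD(E,p)` on (ram) pairs. Its
printed suppliers at `p ∥ N` all fail on (NW) ∩ off-Locus BY HYPOTHESIS, not by accident:
* Eisenstein-congruence divisibilities need a prime of `N` NON-SPLIT in the CM field — Wan 2020 as quoted by JSW17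
  §6.1 («at least one prime divisor of `N` non-split in `𝒦`»), Fouquet–Wan arXiv:2107.13726 Thm. 4.41 (clean
  inclusion: every non-split `ℓ ∣ N` RAMIFIED in `𝒦` with `π_ℓ` = Steinberg ⊗ unramified quadratic, i.e. `E`
  NON-split multiplicative at `ℓ`) — hence Castella's erratum Thm. A′ (iii); (NW) has no such odd `q`. Base change
  (Burungale–Castella–Skinner, IMRN 2025, Thm. 1.2.4) removes (ram) but is printed for GOOD ORDINARY `p` only.
* The Kolyvagin-system road needs Λ-PRIMITIVITY (a non-zero mod-`p` class): W. Zhang 2014 ∕ Skinner–Zhang 2014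
  Thm. 1.3 (♠ forces `p ∤ c_ℓ`); off the Locus every mod-`p` class VANISHES (Jetchev 2008 Thm. 1.4 at `p ∤ N`:
  `M_∞ ≥ max ord_p c_q`; granted BSD, `M_∞ = t ≥ 1`) — the right input is a certificate of level `t + 1`.
* The refined statement `M_∞ = Σ_ℓ ord_p c_ℓ` (W. Zhang's refined Kolyvagin conjecture) is PROVED at good
  ordinary `p > 3` (Burungale–Castella–Grossi–Skinner arXiv:2312.09301 = Camb. J. Math., Thm. 2;
  Castella–Sano arXiv:2601.14504 Thm. 3) — NOTHING at `p ∣ N`.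
* The cyclotomic lever (Skinner 2016 Thm. A + Stein–Wuthrich Thm. 6.1 + Disegni 2020 Thm. 1) reaches every (ram)
  pair modulo the `p`-adic regulator (`ClassClosure.bsdp_of_ram_…_of_schneider`) — a DIFFERENT rider, not used.
* BBV16 assumes `p ∤ ∏ c_ℓ` and good ordinary (JSW17 §1.2); the bipartite anticyclotomic main conjectures of
  arXiv:2306.17784 (Math. Ann. 2026) assume `p ∤ N`; CGLS22 ∕ CGS25 are Eisenstein. The anticyclotomic CONTROL
  theorem is NOT the obstruction: JSW17 Thm. 3.3.1-mult carries the Tamagawa factor (`p2ControlOnTreeAt_of_thm331Mult`).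
So the (NW) ∩ off-Locus supplier is, in the tree's currency, EXACTLY ONE statement: a level-`(t+1)` Kolyvagin
certificate (`M_∞ ≤ t`) at a multiplicative `p ≥ 5` — OPEN, conjecture-grade, refereed at good `p`. This file is the
kernel-checked composition «that statement ⟹ the registered stub», the off-Locus twin of the Locus road, which it
SUBSUMES (§5: on `p ∤ ∏ c_ℓ` a non-zero mod-`p` class is a level-`1` certificate and `t = 0`).

## What this file proves

* §1 `missingLowerBoundAt_of_kolyvaginTamFramesHLAt` — AT A PAIR `(E, p)` in X11b (any odd `p ∥ N`) with a
  (ram) witness (NO Tamagawa, torsion or witness-type hypothesis): published facts + seam `hKD` + McCallum + `hZt`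
  (a certificate of level `M+1`, `M ≤ ord_p ∏ c_ℓ(E)`, at every Manin-good conductor-1 frame of every
  Hoffstein–Luo field OF THIS PAIR) ⟹ `Typed.MissingLowerBoundAt W p` (the lower half of `BSD(E,p)`). Proof: one
  Hoffstein–Luo datum with `d_K < −4`; koly's `Koly.indexLowerBoundAt_of_certificateAt_of_mccallum` (STEP L at that
  datum from the certificate); multr1-p2's rigidity `indexLowerBoundAt_iff_missingLowerBoundAt_of_heegnerData_of_odd`.
* §2 `openInputOnTreeAt_of_kolyvaginTamFramesHLAt` — the same + the control identity `P2ControlOnTreeAt W p` ⟹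
  `P2OpenInputOnTreeAt W p` (rigidity back to STEP L at EVERY odd datum, then the tightness §1 of multr1-p2).
* §3 `openInputOnTree_onRam_of_kolyvaginTamFramesHL_of_thm331Mult` — class level on ALL (ram) pairs of X11b at
  `p ≥ 5` (Locus AND off-Locus, (T) branch included), seam by Darmon Thm. 3.6 (`h36`), control by JSW17 (`h331`).
* §4 `stub_nw_offLocus_of_kolyvaginTamFramesHL_of_thm331Mult` — THE REGISTERED SIGNATURE of `stub_nw_offLocus`
  (skeleton `Cruxes/Rest3NoWitnessBranchAtFive/Lines/birth.lean`, sha 56b32573…) VERBATIM, from the published facts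
  and `hZt` asked ONLY on the (NW) ∩ off-Locus pairs (X11b, `p ≥ 5`, `ρ̄` onto, (ram), `p ∣ ∏ c_ℓ`,
  `E(ℚ_p)[p] = 0`, every odd non-split multiplicative `q ≠ p` has `p ∣ v_q(Δ_min)`).
* §5 `kolyvaginTamCertificate_of_kolyvaginClass_one_ne_zero` — bookkeeping: on `p ∤ ∏ c_ℓ` the Locus input (a
  non-zero `c_1(n)`, `n ∈ Λ`) IS the refined input with `M = t = 0`.

PER-PAIR READING (rungs; nothing asserted): at a datum with `ord_p [E(K):ℤP] ≤ t` the conductor-1 frame itself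
is a level-`(M₀+1)` certificate, so STEP L there needs NO Kolyvagin prime (Tamagawa-slack index certificate; e.g.
`(5595f1, 5)`: `ord₅ [E(K):ℤy_K] = 1 = ord₅ c₃`, rest-p2 kit j255090); the content of `hZt` is at `Ш(E/K)[p] ≠ 0`.

References (locators only): [cite: McCallumLMS1991, §5 Cor. 5.6 (p. 310), Lemma 5.1 (p. 303)] [cite: Darmon2004, Thm. 3.6]
[cite: WZhang2014, Thm. 1.1 (p. 195), Remark 5 and Thm. 10.2 (p. 199)] [cite: SkinnerZhang2014, Thm. 1.3 (§1 p. 3)]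
[cite: Jetchev2008, Thm. 1.4 and Cor. 1.5 (p. 3)] [cite: JetchevSkinnerWan2017, Thm. 3.3.1, §7.4.1 (pp. 30–31), §6.1 (p. 26)]
[cite: Castella2018Erratum, Thm. 1.1 (iii)–(iv), (2.4)] [cite: BurungaleCastellaSkinner2025, Thm. 1.2.4, Thm. 4.1.3 (p ∤ 2N)].
-/

-- the Theorems namespace of this sub repeats the summit name by design (D-0017 nested layout)
set_option linter.dupNamespace false

noncomputable section

open scoped Classical

namespace Summit.BirchSwinnertonDyer.BirchSwinnertonDyer.Theorems

open WeierstrassCurve NumberField Literature.NumberTheory.EllipticCurves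
  Literature.NumberTheory.EllipticCurves.ModularForms
  Literature.NumberTheory.EllipticCurves.Rank1Residual
  Literature.NumberTheory.EllipticCurves.Rank1Residual.Typed
  Summit.BirchSwinnertonDyer.Rank1Residual Summit.BirchSwinnertonDyer.Rank1Residual.X11b
  Summit.BirchSwinnertonDyer.Rank1Residual.X11b.Three.Koly

/-! ### §1 At a pair (every odd `p`): the lower half of `BSD(E,p)` from a Tamagawa-level certificate -/

/-- **The Tamagawa-refined Kolyvagin road AT A PAIR `(E, p)` on the WHOLE (ram) atom, every odd `p`** (no hypothesis
on `∏ c_ℓ`, on `E(ℚ_p)[p]` or on the splitting type of the witness): for `(E, p)` in class X11b (`r_an = 1`, `p ∥ N`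
odd, `E[p]` irreducible) with a (ram) witness, under the published named facts (Gross–Zagier, Kolyvagin,
Skinner 2016 Thm. C, GZK, modularity, newforms, Hoffstein–Luo, Mazur's Manin constant, Shimura reciprocity at
conductor 1), the seam `hKD` (conductor-1 Kolyvagin–Heegner data on every admissible frame), McCallum's structure
theorem `hMc`, and `hZt` — at every Manin-good conductor-1 frame `(Dt, β, ι)` of every Hoffstein–Luo field of THIS
pair (`K` imaginary quadratic, `d_K` odd, Heegner for `N_E`, `L(E^{d_K},1) ≠ 0`, `d_K ≠ −3`), a Kolyvagin certificate
of SOME level `M + 1` with `M ≤ ord_p ∏_ℓ c_ℓ(E)` (`Koly.CertificateAt Dt β ι p M`: a square-free product `n` of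
Kolyvagin primes of index `≥ M + 1` whose derived point satisfies `P_n ∉ p^{M+1} E(K[n])`; HYPOTHESIS — W. Zhang's
refined non-vanishing `M_∞ ≤ ord_p ∏ c_ℓ`) —: the lower half `Typed.MissingLowerBoundAt W p` of `BSD(E,p)`
(`ord_p #Ш(E)_an ≤ ord_p #Ш(E)`). Proof: ONE Hoffstein–Luo datum with `d_K < −4` (`exists_oddHeegnerData_discr_lt`),
its conductor-1 datum descending to the Heegner point, `y_K` non-torsion, rank one, `Ш(E/K)` finite, `E(K)[p] = 0`,
`p^{M₀} ∥ y_K`, tower surjectivity from `Surj ∧ Ram`; then koly's kernel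
`Koly.indexLowerBoundAt_of_certificateAt_of_mccallum` (STEP L `2·ord_p[E(K):ℤy_K] ≤ ord_p #Ш(E/K) + 2t` at that
datum) and multr1-p2's rigidity `indexLowerBoundAt_iff_missingLowerBoundAt_of_heegnerData_of_odd`. CONDITIONAL on
every binder; nothing booked. [cite: McCallumLMS1991, §5 Cor. 5.6 (p. 310) and Lemma 5.1 (p. 303)]
[cite: WZhang2014, Remark 5 and Thm. 10.2 (p. 199) — shape of `hZt` at t = 0] [cite: HoffsteinLuo1997, Theorem (§1)]
[cite: JetchevSkinnerWan2017, §7.4.1 (pp. 30–31)] [cite: Skinner2016PacificMC, Thm. C (§1) and footnote 1] -/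
theorem missingLowerBoundAt_of_kolyvaginTamFramesHLAt
    -- published named facts
    (hGZ : ∀ (N : ℕ) [NeZero N] (W : WeierstrassCurve ℚ) (K : Type) [Field K] [NumberField K],
      gross_zagier N W K)
    (hKo : ∀ (N : ℕ) [NeZero N] (W : WeierstrassCurve ℚ) (K : Type) [Field K] [NumberField K],
      kolyvagin N W K)
    (hSk : Skinner2016.thmC_padicValRat_bsd_rank_zero)
    (hGZK : rank_eq_analyticRank_of_analyticRank_le_one) (hmod : hasEntireLFunction_rat)
    (hnf : exists_isNewformOf) (hHL : HoffsteinLuo1997_exists_twist_L_one_ne_zero)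
    (hMaz : mazur_not_dvd_maninConstant_of_odd)
    (hrec : ∀ (N : ℕ) [NeZero N] (W : WeierstrassCurve ℚ) (K : Type) [Field K] [NumberField K],
      heegnerPointOfConductor_one_galoisConj N W K)
    (hMc : McCallum1991_pow_dvd_card_sha_primary_of_certificate)
    -- SEAM G-a: conductor-1 Kolyvagin–Heegner data exist on every admissible frame (hypothesis shape)
    (hKD : ∀ (W : WeierstrassCurve ℚ) [W.IsElliptic] [W.IsGloballyMinimal] [NeZero (W.conductorNorm ℤ)]
      (K : Type) [Field K] [NumberField K]
      (Dt : ModularParametrizationData W (W.conductorNorm ℤ)) (β : ℤ) (ι : K →+* ℂ),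
      IsImaginaryQuadratic K → SatisfiesHeegnerHypothesis (W.conductorNorm ℤ) K →
      (4 * (W.conductorNorm ℤ : ℤ)) ∣ β ^ 2 - NumberField.discr K →
      Nonempty (KolyvaginHeegnerData Dt β ι 1))
    -- the pair: X11b, p ≥ 5, a (ram) witness — nothing else
    (W : WeierstrassCurve ℚ) [W.IsElliptic] [W.IsGloballyMinimal] [NeZero (W.conductorNorm ℤ)]
    (p : ℕ) [hp : Fact p.Prime]
    (hX : ClassX11b W p) (hram : Ram W p)
    -- refined Kolyvagin non-vanishing (a certificate of level M+1, M ≤ ord_p ∏ c_ℓ) at every Manin-good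
    -- conductor-1 frame of every Hoffstein–Luo field OF THIS PAIR (hypothesis shape)
    (hZt : ∀ (K : Type) [Field K] [NumberField K]
      (Dt : ModularParametrizationData W (W.conductorNorm ℤ)) (β : ℤ) (ι : K →+* ℂ),
      IsImaginaryQuadratic K → Odd (NumberField.discr K) →
      SatisfiesHeegnerHypothesis (W.conductorNorm ℤ) K →
      (W.quadraticTwist (NumberField.discr K : ℚ)).entireLFunction 1 ≠ 0 →
      NumberField.discr K ≠ -3 →
      (4 * (W.conductorNorm ℤ : ℤ)) ∣ β ^ 2 - NumberField.discr K → ¬ (p : ℤ) ∣ Dt.c →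
      ∃ M : ℕ, M ≤ padicValNat p W.tamagawaProduct ∧ CertificateAt Dt β ι p M) :
    Typed.MissingLowerBoundAt W p := by
  obtain ⟨hr, hp2, hmult, hirr⟩ := hX
  -- ONE odd Heegner datum with a Manin-good frame (Hoffstein–Luo field with d_K < -4; Mazur; w_K = 2)
  obtain ⟨K, _, _, Dt, H, ι, P, Wd, _, _, Cd, hK, hodd, hlt, -, hHN, hP, hc, hμ, hLt, hWd⟩ :=
    exists_oddHeegnerData_discr_lt hnf hHL hMaz integral_neronScaling_of_isGloballyMinimal_holds W p hr
      hp2 hmult hirr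
  have h3 : NumberField.discr K ≠ -3 := by omega
  have h4 : NumberField.discr K ≠ -4 := by omega
  -- seam G-a: a conductor-1 Kolyvagin–Heegner datum on the frame (Dt, H.β, ι)
  obtain ⟨d₁⟩ := hKD W K Dt H.β ι hK hHN H.dvd_sq_sub
  -- the bottom point: P(1) = y_K = P in E(K̄) (Shimura reciprocity at conductor 1, named fact `hrec`)
  have hPd : d₁.toGeomPoints d₁.derivedPoint = toGeomPoints (W.baseChange K) P :=
    KolyvaginBottom.toGeomPoints_derivedPoint_one_eq (hrec _ W K) hK hHN hP d₁ rfl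
  -- y_K is non-torsion (Gross–Zagier at r_an = 1 with L(E^{d_K},1) ≠ 0); rank one, Ш finite (Kolyvagin)
  have hPinf : ¬ IsOfFinAddOrder P :=
    not_isOfFinAddOrder_of_heegner_of_analyticRank_eq_one W (W.conductorNorm ℤ) K Dt H ι P (hGZ _ W K) hmod
      hr hK hHN hLt hP
  obtain ⟨hrank, hSha⟩ := hKo (W.conductorNorm ℤ) W K hK hHN ⟨Dt, H, ι, hP⟩ hPinf
  haveI : Finite (W.baseChange K).sha := hSha
  -- E(K)[p] = 0 (E[p] irreducible, K imaginary quadratic)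
  have hbot := torsionBy_eq_bot_of_isImaginaryQuadratic_of_hasIrreducibleModPGaloisRep W K hK hp.out hirr
  have hiv : ∀ x : (W.baseChange K).toAffine.Point, p • x = 0 → x = 0 := fun x hx ↦ by
    have hmem : x ∈ AddSubgroup.torsionBy (W.baseChange K).toAffine.Point ((p : ℕ) : ℤ) := by
      rw [mem_torsionBy_iff, natCast_zsmul]
      exact hx
    rw [hbot] at hmem
    exact hmem
  -- the exponent p^{M₀} ∥ y_K (Mordell–Weil)
  haveI : Module.Finite ℤ (W.baseChange K).toAffine.Point := (W.baseChange K).module_finite_point_holds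
  obtain ⟨M₀, x₀, hx₀, hmax⟩ := exists_pow_smul_eq_and_forall_ne hPinf (p := p) hp.out.two_le
  have hdiv : ∃ Q : (W.baseChange K).toAffine.Point, ((p ^ M₀ : ℕ) : ℤ) • Q = P :=
    ⟨x₀, by rw [natCast_zsmul]; exact hx₀⟩
  have hndiv : ¬ ∃ Q : (W.baseChange K).toAffine.Point, ((p ^ (M₀ + 1) : ℕ) : ℤ) • Q = P := by
    rintro ⟨Q, hQ⟩
    exact hmax Q (by rw [← natCast_zsmul]; exact hQ)
  -- tower surjectivity from Surj ∧ Ram; non-CM from the multiplicative prime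
  have hρ : Surj W p := surj_of_irr_of_ram W p hirr hram
  have hsurj : ∀ m : ℕ, W.HasSurjectiveModNGaloisRep (p ^ m : ℕ) :=
    hasSurjectiveModNGaloisRep_pow_of_hasMultiplicativeReductionAtPrime W p hρ hram
  have hCM : ¬ W.HasCM := not_hasCM_of_hasMultiplicativeReductionAtPrime' W hmult
  -- the refined certificate at this Manin-good frame of THIS Hoffstein–Luo pair
  obtain ⟨M, hMt, hcert⟩ := hZt K Dt H.β ι hK hodd hHN hLt h3 H.dvd_sq_sub hc
  -- STEP L at the datum (koly's K0⋆ kernel on McCallum's structure theorem)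
  have hL : IndexLowerBoundAt W p K P :=
    indexLowerBoundAt_of_certificateAt_of_mccallum W K hMc hCM hK h3 h4 hHN p hp2 hsurj Dt H.β ι d₁ P hPd
      hPinf hrank hiv hdiv hndiv hcert hMt
  -- rigidity: STEP L at an odd Heegner datum of a (ram) pair IS the lower half of BSD(E,p)
  exact (indexLowerBoundAt_iff_missingLowerBoundAt_of_heegnerData_of_odd W p K Dt H ι P (hGZ _ W K)
    (hKo _ W K) hSk hGZK hmod hr hp2 hmult hirr hram hK hodd hHN hP hc hμ hLt Wd Cd hWd).1 hL

/-! ### §2 At a pair: route p2's open input from the Tamagawa-refined road -/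

/-- **The Tamagawa-refined Kolyvagin road gives route p2's OPEN INPUT at a (ram) pair of X11b**: the hypotheses
of `missingLowerBoundAt_of_kolyvaginTamFramesHLAt` plus the control identity `P2ControlOnTreeAt W p`
(Cas18 Thm. 2.3 ∕ JSW17 Thm. 3.3.1, PUB shape) ⟹ `P2OpenInputOnTreeAt W p` — the lower half of `BSD(E,p)` by §1,
then imc-p1's ONE-SIDED tightness `openInputOnTreeAt_of_missingLowerBoundAt_of_ram` (rigidity back to STEP L at
every odd Manin-good datum — Gross–Zagier, Kolyvagin, Skinner 2016 Thm. C for the twist — and the control identity).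
No Tamagawa hypothesis; the EQUALITY `BSD(E,p)` is NOT obtained (off the Locus the Euler-system half is Jetchev's
direction, not touched here). CONDITIONAL on every binder; nothing booked.
[cite: Castella2018, Thm. 2.3 (p. 5), Thm. 3.2 (p. 9), (1.1) (p. 2)] [cite: JetchevSkinnerWan2017, §7.4.1 (pp. 30–31)]
[cite: McCallumLMS1991, §5 Cor. 5.6 (p. 310)] -/
theorem openInputOnTreeAt_of_kolyvaginTamFramesHLAt
    (hGZ : ∀ (N : ℕ) [NeZero N] (W : WeierstrassCurve ℚ) (K : Type) [Field K] [NumberField K],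
      gross_zagier N W K)
    (hKo : ∀ (N : ℕ) [NeZero N] (W : WeierstrassCurve ℚ) (K : Type) [Field K] [NumberField K],
      kolyvagin N W K)
    (hSk : Skinner2016.thmC_padicValRat_bsd_rank_zero)
    (hGZK : rank_eq_analyticRank_of_analyticRank_le_one) (hmod : hasEntireLFunction_rat)
    (hnf : exists_isNewformOf) (hHL : HoffsteinLuo1997_exists_twist_L_one_ne_zero)
    (hMaz : mazur_not_dvd_maninConstant_of_odd)
    (hrec : ∀ (N : ℕ) [NeZero N] (W : WeierstrassCurve ℚ) (K : Type) [Field K] [NumberField K],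
      heegnerPointOfConductor_one_galoisConj N W K)
    (hMc : McCallum1991_pow_dvd_card_sha_primary_of_certificate)
    (hKD : ∀ (W : WeierstrassCurve ℚ) [W.IsElliptic] [W.IsGloballyMinimal] [NeZero (W.conductorNorm ℤ)]
      (K : Type) [Field K] [NumberField K]
      (Dt : ModularParametrizationData W (W.conductorNorm ℤ)) (β : ℤ) (ι : K →+* ℂ),
      IsImaginaryQuadratic K → SatisfiesHeegnerHypothesis (W.conductorNorm ℤ) K →
      (4 * (W.conductorNorm ℤ : ℤ)) ∣ β ^ 2 - NumberField.discr K →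
      Nonempty (KolyvaginHeegnerData Dt β ι 1))
    (W : WeierstrassCurve ℚ) [W.IsElliptic] [W.IsGloballyMinimal] [NeZero (W.conductorNorm ℤ)]
    (p : ℕ) [Fact p.Prime]
    (hX : ClassX11b W p) (hram : Ram W p)
    -- the control IDENTITY at the pair (PUB shape)
    (hC : P2ControlOnTreeAt W p)
    (hZt : ∀ (K : Type) [Field K] [NumberField K]
      (Dt : ModularParametrizationData W (W.conductorNorm ℤ)) (β : ℤ) (ι : K →+* ℂ),
      IsImaginaryQuadratic K → Odd (NumberField.discr K) →
      SatisfiesHeegnerHypothesis (W.conductorNorm ℤ) K →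
      (W.quadraticTwist (NumberField.discr K : ℚ)).entireLFunction 1 ≠ 0 →
      NumberField.discr K ≠ -3 →
      (4 * (W.conductorNorm ℤ : ℤ)) ∣ β ^ 2 - NumberField.discr K → ¬ (p : ℤ) ∣ Dt.c →
      ∃ M : ℕ, M ≤ padicValNat p W.tamagawaProduct ∧ CertificateAt Dt β ι p M) :
    P2OpenInputOnTreeAt W p :=
  openInputOnTreeAt_of_missingLowerBoundAt_of_ram W p hGZ hKo hSk hGZK hmod hC hram
    (missingLowerBoundAt_of_kolyvaginTamFramesHLAt hGZ hKo hSk hGZK hmod hnf hHL hMaz hrec hMc hKD W p hX hram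
      hZt)

/-! ### §3 Class level: the whole (ram) atom of X11b at `p ≥ 5` -/

/-- **The Tamagawa-refined Kolyvagin road on the WHOLE (ram) atom at `p ≥ 5`, class level, ∀-frame ♯ typing**
(Locus and off-Locus alike; the (T) branch `E(ℚ_p)[p] ≠ 0` included; the splitting type of the witness is not
read): published facts + McCallum + Darmon Thm. 3.6 at conductor 1 (`h36`, discharging the seam) + JSW17
Thm. 3.3.1-mult (`h331`, the control identity) + `hZt` (a certificate of level `M+1`, `M ≤ ord_p ∏ c_ℓ(E)`, at every
Manin-good conductor-1 frame of every Hoffstein–Luo field of every X11b pair with `p ≥ 5`, `p ∥ N`, `ρ̄` onto and a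
(ram) witness; HYPOTHESIS — W. Zhang's refined Kolyvagin non-vanishing `M_∞ ≤ ord_p ∏ c_ℓ`, proved at good ordinary
`p > 3` only) ⟹ route p2's open input `P2OpenInputOnTreeAt W p` at every X11b pair with `p ≥ 5` and a (ram)
witness. CONDITIONAL on every binder; nothing booked. [cite: McCallumLMS1991, §5 Cor. 5.6 (p. 310)] [cite: Darmon2004, Thm. 3.6]
[cite: JetchevSkinnerWan2017, Thm. 3.3.1 and §7.4.1] [cite: WZhang2014, Thm. 1.1 (p. 195), Remark 5 (p. 199) — shape of `hZt`] -/
theorem openInputOnTree_onRam_of_kolyvaginTamFramesHL_of_thm331Mult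
    (hGZ : ∀ (N : ℕ) [NeZero N] (W : WeierstrassCurve ℚ) (K : Type) [Field K] [NumberField K],
      gross_zagier N W K)
    (hKo : ∀ (N : ℕ) [NeZero N] (W : WeierstrassCurve ℚ) (K : Type) [Field K] [NumberField K],
      kolyvagin N W K)
    (hSk : Skinner2016.thmC_padicValRat_bsd_rank_zero)
    (hGZK : rank_eq_analyticRank_of_analyticRank_le_one) (hmod : hasEntireLFunction_rat)
    (hnf : exists_isNewformOf) (hHL : HoffsteinLuo1997_exists_twist_L_one_ne_zero)
    (hMaz : mazur_not_dvd_maninConstant_of_odd)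
    (hrec : ∀ (N : ℕ) [NeZero N] (W : WeierstrassCurve ℚ) (K : Type) [Field K] [NumberField K],
      heegnerPointOfConductor_one_galoisConj N W K)
    (hMc : McCallum1991_pow_dvd_card_sha_primary_of_certificate)
    (h36 : ∀ (N : ℕ) [NeZero N] (W : WeierstrassCurve ℚ) (K : Type) [Field K] [NumberField K],
      phi_heegnerTau_mem_range_map_singularModuliField N W K)
    (h331 : JetchevSkinnerWan2017.thm331_anticyclotomicControl_mult)
    -- refined Kolyvagin non-vanishing, ∀-frame ♯ typing at p ≥ 5, on the (ram) pairs at Hoffstein–Luo fields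
    (hZt : ∀ (W : WeierstrassCurve ℚ) [W.IsElliptic] [W.IsGloballyMinimal] [NeZero (W.conductorNorm ℤ)]
      (p : ℕ) [Fact p.Prime] (K : Type) [Field K] [NumberField K]
      (Dt : ModularParametrizationData W (W.conductorNorm ℤ)) (β : ℤ) (ι : K →+* ℂ),
      ClassX11b W p → 5 ≤ p → W.HasMultiplicativeReductionAtPrime p → Rank1Residual.Surj W p →
      Rank1Residual.Ram W p →
      IsImaginaryQuadratic K → Odd (NumberField.discr K) →
      SatisfiesHeegnerHypothesis (W.conductorNorm ℤ) K →
      (W.quadraticTwist (NumberField.discr K : ℚ)).entireLFunction 1 ≠ 0 →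
      NumberField.discr K ≠ -3 →
      (4 * (W.conductorNorm ℤ : ℤ)) ∣ β ^ 2 - NumberField.discr K → ¬ (p : ℤ) ∣ Dt.c →
      ∃ M : ℕ, M ≤ padicValNat p W.tamagawaProduct ∧ CertificateAt Dt β ι p M) :
    ∀ (W : WeierstrassCurve ℚ) [W.IsElliptic] [W.IsGloballyMinimal] (p : ℕ) [Fact p.Prime],
      ClassX11b W p → 5 ≤ p → Rank1Residual.Ram W p → P2OpenInputOnTreeAt W p := by
  intro W _ _ p hp hX hp5 hram
  haveI : NeZero (W.conductorNorm ℤ) := ⟨(W.conductorNorm_pos_holds).ne'⟩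
  have hmult : W.HasMultiplicativeReductionAtPrime p := hX.2.2.1
  have hs : Rank1Residual.Surj W p := surj_of_irr_of_ram W p hX.2.2.2 hram
  exact openInputOnTreeAt_of_kolyvaginTamFramesHLAt hGZ hKo hSk hGZK hmod hnf hHL hMaz hrec hMc
    (kolyvaginRoadThree_hKD_of_darmon36 h36) W p hX hram (p2ControlOnTreeAt_of_thm331Mult W p h331 hKo)
    (fun K _ _ Dt β ι hK hodd hHN hLt h3 hβ hc ↦
      hZt W p K Dt β ι hX hp5 hmult hs hram hK hodd hHN hLt h3 hβ hc)

/-! ### §4 The registered stub `stub_nw_offLocus` of crux 19703, VERBATIM, from the refined road -/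

/-- **`stub_nw_offLocus` (crux `Rest3NoWitnessBranchAtFive`, item 19703; registered signature VERBATIM) from the
Tamagawa-refined Kolyvagin road.** For every globally minimal elliptic `W/ℚ` and prime `p` with a (ram) witness,
`E(ℚ_p)[p] = 0`, NO odd non-split `E[p]`-ramified multiplicative `q ≠ p`, and `p ∣ ∏_ℓ c_ℓ(E)` (cw 18 793 pairs,
`N < 5·10⁵`): route p2's open input `P2OpenInputOnTreeAt W p` — from the published named facts (`hGZ hKo hSk hGZK
hmod hnf hHL hMaz hrec`), McCallum's structure theorem (`hMc`), Darmon Thm. 3.6 at conductor 1 (`h36`), the JSW17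
Thm. 3.3.1-mult control fact (`h331`), and ONE hypothesis-shaped input `hZt` asked ONLY on these pairs: at every
Manin-good conductor-1 frame `(Dt, β, ι)` of every Hoffstein–Luo field (`d_K` odd, Heegner for `N_E`,
`L(E^{d_K},1) ≠ 0`, `d_K ≠ −3`) of an X11b pair with `p ≥ 5`, `ρ̄_{E,p}` onto, a (ram) witness, `p ∣ ∏ c_ℓ`,
`E(ℚ_p)[p] = 0` and every odd non-split multiplicative `q ≠ p` `E[p]`-unramified, there is a Kolyvagin
certificate of some level `M + 1` with `M ≤ ord_p ∏_ℓ c_ℓ(E)` (`Koly.CertificateAt Dt β ι p M`; W. Zhang's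
refined non-vanishing `M_∞ ≤ t`, the `t > 0` twin of Skinner–Zhang Thm. 1.3 — OPEN at `p ∥ N`; at good ordinary
`p > 3` it is Burungale–Castella–Grossi–Skinner Thm. 2). Inside the open input's binders the pair is in X11b with
`p ≥ 5` and `ρ̄` onto, so §2 applies with the seam and the control identity discharged as in §3; the item OWNER
assembles via `Rest3NoWitnessBranchAtFive_of` (this is its `hT` modulo `hZt` and the named facts). CONDITIONAL on
every binder; nothing booked. [cite: McCallumLMS1991, §5 Cor. 5.6 (p. 310)] [cite: Darmon2004, Thm. 3.6]
[cite: SkinnerZhang2014, Thm. 1.3 (§1 p. 3) — shape of `hZt` at t = 0] [cite: JetchevSkinnerWan2017, Thm. 3.3.1, §7.4.1] -/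
theorem stub_nw_offLocus_of_kolyvaginTamFramesHL_of_thm331Mult
    (hGZ : ∀ (N : ℕ) [NeZero N] (W : WeierstrassCurve ℚ) (K : Type) [Field K] [NumberField K],
      gross_zagier N W K)
    (hKo : ∀ (N : ℕ) [NeZero N] (W : WeierstrassCurve ℚ) (K : Type) [Field K] [NumberField K],
      kolyvagin N W K)
    (hSk : Skinner2016.thmC_padicValRat_bsd_rank_zero)
    (hGZK : rank_eq_analyticRank_of_analyticRank_le_one) (hmod : hasEntireLFunction_rat)
    (hnf : exists_isNewformOf) (hHL : HoffsteinLuo1997_exists_twist_L_one_ne_zero)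
    (hMaz : mazur_not_dvd_maninConstant_of_odd)
    (hrec : ∀ (N : ℕ) [NeZero N] (W : WeierstrassCurve ℚ) (K : Type) [Field K] [NumberField K],
      heegnerPointOfConductor_one_galoisConj N W K)
    (hMc : McCallum1991_pow_dvd_card_sha_primary_of_certificate)
    (h36 : ∀ (N : ℕ) [NeZero N] (W : WeierstrassCurve ℚ) (K : Type) [Field K] [NumberField K],
      phi_heegnerTau_mem_range_map_singularModuliField N W K)
    (h331 : JetchevSkinnerWan2017.thm331_anticyclotomicControl_mult)
    -- refined Kolyvagin non-vanishing, ∀-frame ♯ typing, asked ONLY on the (NW) ∩ off-Locus pairs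
    (hZt : ∀ (W : WeierstrassCurve ℚ) [W.IsElliptic] [W.IsGloballyMinimal] [NeZero (W.conductorNorm ℤ)]
      (p : ℕ) [Fact p.Prime] (K : Type) [Field K] [NumberField K]
      (Dt : ModularParametrizationData W (W.conductorNorm ℤ)) (β : ℤ) (ι : K →+* ℂ),
      ClassX11b W p → 5 ≤ p → W.HasMultiplicativeReductionAtPrime p → Rank1Residual.Surj W p →
      Rank1Residual.Ram W p → p ∣ W.tamagawaProduct →
      (∀ P : (W.baseChange ℚ_[p]).toAffine.Point, p • P = 0 → P = 0) →
      (∀ (q : ℕ) [Fact q.Prime], q ≠ 2 → q ≠ p → Rank1Residual.Mult W q →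
        ¬ W.HasSplitMultiplicativeReductionAtPrime q → p ∣ padicValInt q W.minimalDiscriminantInt) →
      IsImaginaryQuadratic K → Odd (NumberField.discr K) →
      SatisfiesHeegnerHypothesis (W.conductorNorm ℤ) K →
      (W.quadraticTwist (NumberField.discr K : ℚ)).entireLFunction 1 ≠ 0 →
      NumberField.discr K ≠ -3 →
      (4 * (W.conductorNorm ℤ : ℤ)) ∣ β ^ 2 - NumberField.discr K → ¬ (p : ℤ) ∣ Dt.c →
      ∃ M : ℕ, M ≤ padicValNat p W.tamagawaProduct ∧ CertificateAt Dt β ι p M) :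
    ∀ (W : WeierstrassCurve ℚ) [W.IsElliptic] [W.IsGloballyMinimal] (p : ℕ) [Fact p.Prime],
      Literature.NumberTheory.EllipticCurves.Rank1Residual.Ram W p →
      (∀ P : (W.baseChange ℚ_[p]).toAffine.Point, p • P = 0 → P = 0) →
      ¬ (∃ (q : ℕ) (_ : Fact q.Prime), q ≠ 2 ∧ q ≠ p ∧ Literature.NumberTheory.EllipticCurves.Rank1Residual.Mult W q ∧
          ¬ W.HasSplitMultiplicativeReductionAtPrime q ∧ ¬ p ∣ padicValInt q W.minimalDiscriminantInt) →
      p ∣ W.tamagawaProduct →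
      Summit.BirchSwinnertonDyer.Rank1Residual.X11b.P2OpenInputOnTreeAt W p := by
  intro W _ _ p hp hram htf hnw htam N _ K _ _ Dt H ι P hX hp5 hs hN hK hodd hpd hμ hHN hLt hP hc hPinf κ hκ γ _ 𝔭 h𝔭
    he hf
  haveI : NeZero (W.conductorNorm ℤ) := ⟨(W.conductorNorm_pos_holds).ne'⟩
  have hmult : W.HasMultiplicativeReductionAtPrime p := hX.2.2.1
  -- the (NW) clause in ∀-form
  have hα : ∀ (q : ℕ) [Fact q.Prime], q ≠ 2 → q ≠ p → Rank1Residual.Mult W q →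
      ¬ W.HasSplitMultiplicativeReductionAtPrime q → p ∣ padicValInt q W.minimalDiscriminantInt := by
    intro q _ hq2 hqp hmq hnsq
    by_contra hv
    exact hnw ⟨q, inferInstance, hq2, hqp, hmq, hnsq, hv⟩
  exact openInputOnTreeAt_of_kolyvaginTamFramesHLAt hGZ hKo hSk hGZK hmod hnf hHL hMaz hrec hMc
    (kolyvaginRoadThree_hKD_of_darmon36 h36) W p hX hram (p2ControlOnTreeAt_of_thm331Mult W p h331 hKo)
    (fun K' _ _ Dt' β ι' hK' hodd' hHN' hLt' h3' hβ hc' ↦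
      hZt W p K' Dt' β ι' hX hp5 hmult hs hram htam htf hα hK' hodd' hHN' hLt' h3' hβ hc')
    N K Dt H ι P hX hp5 hs hN hK hodd hpd hμ hHN hLt hP hc hPinf κ hκ γ 𝔭 h𝔭 he hf

/-! ### §5 Bookkeeping: on the Locus the mod-`p` input IS the refined input -/

/-- **The Locus road's input gives the refined input** (bookkeeping, nothing asserted about either): a non-zero mod-`p`
class `c_1(n)` at a square-free product `n` of Kolyvagin primes (the conclusion of `hZ₅` ∕ `Koly.SkinnerZhangSharp` at the
frame) is a level-`1` certificate (`Koly.certificateAt_zero_of_kolyvaginClass_one_ne_zero`) and `0 ≤ ord_p ∏ c_ℓ`; so §3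
SUBSUMES the Locus road `Koly.openInputOnTree_onLocus_…`. [cite: McCallumLMS1991, Cor. 4.5 (c_M(n) = 0 iff P_n ∈ p^M E(K_n))] -/
theorem kolyvaginTamCertificate_of_kolyvaginClass_one_ne_zero
    {W : WeierstrassCurve ℚ} [W.IsGloballyMinimal] {N : ℕ} [NeZero N]
    {K : Type} [Field K] [NumberField K] {Dt : ModularParametrizationData W N} {β : ℤ} {ι : K →+* ℂ}
    {p : ℕ} [hp : Fact p.Prime] {n : ℕ} (d : KolyvaginHeegnerData Dt β ι n)
    (hn : KolyvaginDescent.KolSupp (Zhang2014.IsKolyvaginPrime N W K p) n)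
    (hne : d.kolyvaginClass hp.out 1 ≠ 0) :
    ∃ M : ℕ, M ≤ padicValNat p W.tamagawaProduct ∧ CertificateAt Dt β ι p M :=
  ⟨0, Nat.zero_le _, certificateAt_zero_of_kolyvaginClass_one_ne_zero d hn hne⟩

end Summit.BirchSwinnertonDyer.BirchSwinnertonDyer.Theorems

end
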